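import Summits.NavierStokesRegularity.NavierStokesRegularity.Theorems.FilamentSkeletonRssTransverseReductionRCensus

/-!
# Route `FilamentSkeletonRss` · crux `TransverseReductionRJ` (stmt-NavierStokesRegularity-21221) — parameter census, ported

`TransverseReductionRJ` (route rev 10) is the junk-proof J-twin of `TransverseReductionR` (stmt-19175): clause 13 of
the box block (weighted injectivity of the linearised normal-tangency map) is restricted to normal test families
SUPPORTED IN THE TANGENCY BALL, and the exponent `a` carries the new hypothesis `0 ≤ a`; everything else is
byte-identical.  The parameter census of the refutation-first lane (p528784, `transverseReductionR_iff_nondegenerate`,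
`not_transverseReductionR_iff_boxWitness`) transfers VERBATIM — it never uses clause 13 except at the zero test family
`Y = 0`, which is supported in the ball trivially:

* `transverseReductionRJ_iff_nondegenerate` — the crux is equivalent to its restriction to the NON-DEGENERATE region
  `cg ≤ 1 ∧ θ₀ ≤ 1 ∧ 0 ≤ K ∧ 3/2 + δ ≤ Λ ∧ 0 ≤ cnd ∧ (2 ≤ N → ρ ≤ 2 Rw) ∧ (N = 1 → 0 < K)` (outside it the box
  hypotheses are contradictory at every `Γ ≥ 1`; lemmas `TransverseReductionRCensus.*` of the rev-9 census file);
* `not_transverseReductionRJ_iff_boxWitness` — `¬ TransverseReductionRJ` holds iff, for some non-degenerate parameter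
  tuple, at arbitrarily large `Γ` the junk-proof tilted box class is INHABITED by a box on which every candidate reduced
  family fails (so an unconditional `¬` still needs an explicit inhabitant — the burden of `SelectionBoxRJ`, minus its
  sign law).

Negative-side bookkeeping only; NOT a claim about NS regularity or blow-up.
-/

set_option linter.dupNamespace false

noncomputable section

namespace Summit.NavierStokesRegularity.NavierStokesRegularity.Theorems

open Set Function Filter MeasureTheory Real
open Literature.Analysis.FluidPDE
open Summit.NavierStokesRegularity.NavierStokesRegularity.Theses.FilamentSkeletonRss
open scoped InnerProductSpace Topology

namespace TransverseReductionRCensus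

/-- The junk-proof (ball-supported) normal-variation clause, tested on `Y = 0` with `L = 1`, forces `0 ≤ cnd`.
[folklore] -/
theorem cnd_nonneg_ball {N : ℕ} {a b cnd R : ℝ} {X : Fin N → ℝ → EuclideanSpace ℝ (Fin 3)} {c : Fin N → ℝ}
    {T : (Fin N → ℝ → EuclideanSpace ℝ (Fin 3)) → Fin N → ℝ → EuclideanSpace ℝ (Fin 3)} (j : Fin N)
    (h13 : ∀ Y : Fin N → ℝ → EuclideanSpace ℝ (Fin 3), (∀ j, ContDiff ℝ 2 (Y j)) →
      (∀ j τ, ⟪Y j τ, deriv (X j) τ⟫_ℝ = 0) → (∀ j τ, R < ‖X j τ‖ → Y j τ = 0) →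
      ∑ j, ⟪Y j (c j), cross (EuclideanSpace.single 2 1) (X j (c j))⟫_ℝ = 0 →
      (∀ j τ, ‖Y j τ‖ + ‖deriv (Y j) τ‖ + ‖iteratedDeriv 2 (Y j) τ‖ ≤ (1 + |τ - c j|) ^ b) →
      ∀ L : ℝ, (∀ j τ, ‖deriv (fun s : ℝ => T (fun k σ => X k σ + s • Y k σ) j τ) 0‖ ≤
        L * (1 + |τ - c j|) ^ a) →
      ∀ j τ, ‖Y j τ‖ ≤ cnd * L * (1 + |τ - c j|) ^ b) : 0 ≤ cnd := by
  have h := h13 (fun _ _ => 0) (fun _ => contDiff_const) (fun _ _ => by simp) (fun _ _ _ => rfl) (by simp)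
    (fun j τ => by
      simp only [norm_zero, deriv_const', iteratedDeriv_const, zero_add]
      split_ifs <;> simp only [norm_zero] <;> exact Real.rpow_nonneg (by positivity) _)
    1 (fun j τ => by
      simp only [smul_zero, add_zero, deriv_const', norm_zero, one_mul]
      exact Real.rpow_nonneg (by positivity) _) j (c j)
  simpa using h

end TransverseReductionRCensus

open TransverseReductionRCensus in
/-- **Parameter census for the J-twin.** `TransverseReductionRJ` is equivalent to its restriction to the
NON-DEGENERATE parameter region `cg ≤ 1 ∧ θ₀ ≤ 1 ∧ 0 ≤ K ∧ 3/2 + δ ≤ Λ ∧ 0 ≤ cnd ∧ (2 ≤ N → ρ ≤ 2 Rw) ∧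
(N = 1 → 0 < K)`: outside it the junk-proof tilted skeleton-box hypotheses are contradictory at every `Γ ≥ 1`
(no-return vs. unit speed; `θ₀ ≤ |α| ≤ θ₀⁻¹`; `‖X″‖√Γ ≤ K`; `3/2 + δ ≤ w′(c) ≤ Λ`; the ball-supported
normal-variation clause at `Y = 0`; separation vs. waists; a single straight filament has `w′ ≡ 1/2`), so the
crux holds there vacuously.  Port of `transverseReductionR_iff_nondegenerate` (p528784). [folklore] -/
theorem transverseReductionRJ_iff_nondegenerate :
    TransverseReductionRJ ↔
    (∀ (N:ℕ) (δ ρ K Λ a b cnd η Rw Rb cg θ₀:ℝ), 0 < N → 0 < δ → 0 < ρ → 0 ≤ a → 0 < η → 0 < Rw → 0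
      < Rb → 0 < cg → 0 < θ₀ → cg ≤ 1 → θ₀ ≤ 1 → 0 ≤ K → 3/2+δ ≤ Λ → 0 ≤ cnd → (2 ≤ N → ρ ≤ 2*Rw) →
      (N = 1 → 0 < K) → ∃ Γ₁:ℝ, ∀ Γ:ℝ, Γ₁≤Γ → ∀ (γ:(Fin N→ℝ) → Fin N → ℝ) (α:(Fin N→ℝ) → ℝ) (X:(Fin
      N→ℝ) → Fin N → ℝ → EuclideanSpace ℝ (Fin 3)) (w:(Fin N→ℝ) → Fin N → ℝ → ℝ) (c:(Fin N→ℝ) → Fin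
      N → ℝ) (m n:(Fin N→ℝ) → Fin N → EuclideanSpace ℝ (Fin 3)) (u:(Fin N→ℝ)→(Fin N → ℝ →
      EuclideanSpace ℝ (Fin 3)) → EuclideanSpace ℝ (Fin 3) → EuclideanSpace ℝ (Fin 3)) (v:(Fin N→ℝ)
      → EuclideanSpace ℝ (Fin 3) → EuclideanSpace ℝ (Fin 3)) (A:(Fin N→ℝ) → Fin N → (EuclideanSpace
      ℝ (Fin 3) →L[ℝ] EuclideanSpace ℝ (Fin 3))) (T:(Fin N→ℝ)→(Fin N → ℝ → EuclideanSpace ℝ (Fin 3))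
      → Fin N → ℝ → EuclideanSpace ℝ (Fin 3)) (D:(Fin N→ℝ) → Fin N → EuclideanSpace ℝ (Fin 3) →
      EuclideanSpace ℝ (Fin 3)), (∀ p Z y, u p Z y = ∑ k, (Γ*γ p k/(4*Real.pi))•∫ σ:ℝ, ((‖y-Z k
      σ‖^2+1)^(3/2:ℝ))⁻¹•cross (deriv (Z k) σ) (y-Z k σ))→(∀ p y, v p y = u p (X p) y+(1/2:ℝ)•y-α
      p•cross (EuclideanSpace.single 2 1) y)→(∀ p j, A p j = fderiv ℝ (v p) (X p j (c p j)))→(∀ p Z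
      j τ, T p Z j τ = (u p Z (Z j τ)+(1/2:ℝ)•Z j τ-α p•cross (EuclideanSpace.single 2 1) (Z j
      τ))-(⟪u p Z (Z j τ)+(1/2:ℝ)•Z j τ-α p•cross (EuclideanSpace.single 2 1) (Z j τ), deriv (Z j)
      τ⟫_ℝ/‖deriv (Z j) τ‖^2)•deriv (Z j) τ)→(∀ p j y, D p j y = (Real.exp (-(⟪y-X p j (c p j),
      deriv (X p j) (c p j)⟫_ℝ)^2)*((1-Real.exp (-(‖y-X p j (c p j)‖^2-⟪y-X p j (c p j), deriv (X p
      j) (c p j)⟫_ℝ^2)))/(‖y-X p j (c p j)‖^2-⟪y-X p j (c p j), deriv (X p j) (c p j)⟫_ℝ^2)))•cross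
      (deriv (X p j) (c p j)) (y-X p j (c p j)))→((∀ j, ContinuousOn (fun q:(Fin N→ℝ) × ℝ => (α q.1,
      γ q.1 j, X q.1 j q.2, w q.1 j q.2)) ({p:Fin N → ℝ | ∀ i, p i ∈ Icc 0 1} ×ˢ univ))∧(∀ p:Fin N →
      ℝ, (∀ i, p i ∈ Icc 0 1) → α p ≠ 0 ∧ (∀ j, γ p j ≠ 0)∧(∀ j, ContDiff ℝ 2 (X p j) ∧
      Differentiable ℝ (w p j)∧(∀ τ, ‖deriv (X p j) τ‖ = 1)∧(∀ τ, ‖iteratedDeriv 2 (X p j) τ‖*√Γ≤K)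
      ∧ Tendsto (fun τ => ‖X p j τ‖) (cocompact ℝ) atTop)∧(∀ j k, j ≠ k → ∀ τ σ, ρ*√Γ≤‖X p j τ-X p k
      σ‖)∧(∀ j τ σ, ρ*√Γ≤|τ-σ| → cg*ρ*√Γ≤‖X p j τ-X p j σ‖)∧(∀ j τ, cg*|τ-c p j|≤Rw*√Γ+‖X p j τ‖)∧(∀
      j τ, w p j τ = ⟪v p (X p j τ), deriv (X p j) τ⟫_ℝ)∧(∀ j τ, ‖X p j τ‖≤Rb*√(Γ*Real.log Γ) → v p
      (X p j τ) = w p j τ•deriv (X p j) τ)∧(∀ j, ‖X p j (c p j)‖≤Rw*√Γ)∧(∀ j, |⟪deriv (X p j) (c p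
      j), EuclideanSpace.single 2 1⟫_ℝ|≤1-θ₀)∧(θ₀≤|α p| ∧ |α p|≤θ₀⁻¹ ∧ ∀ j, θ₀≤|γ p j| ∧ |γ p
      j|≤θ₀⁻¹)∧(∀ j, w p j (c p j) = 0 ∧ (∀ τ, w p j τ = 0 → τ = c p j) ∧ 3/2+δ≤deriv (w p j) (c p
      j) ∧ deriv (w p j) (c p j)≤Λ)∧(∀ j, Orthonormal ℝ ![deriv (X p j) (c p j), m p j, n p j] ∧ ⟪A
      p j (m p j), m p j⟫_ℝ+⟪A p j (n p j), n p j⟫_ℝ < 0 ∧ ⟪A p j (n p j), m p j⟫_ℝ * ⟪A p j (m p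
      j), n p j⟫_ℝ < ⟪A p j (m p j), m p j⟫_ℝ * ⟪A p j (n p j), n p j⟫_ℝ)∧(∀ Y:Fin N → ℝ →
      EuclideanSpace ℝ (Fin 3), (∀ j, ContDiff ℝ 2 (Y j))→(∀ j τ, ⟪Y j τ, deriv (X p j) τ⟫_ℝ = 0) →
      (∀ j τ, Rb*√(Γ*Real.log Γ) < ‖X p j τ‖ → Y j τ = 0) → ∑ j, ⟪Y j (c p j), cross
      (EuclideanSpace.single 2 1) (X p j (c p j))⟫_ℝ = 0 → (∀ j τ, ‖Y j τ‖+‖deriv (Y j)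
      τ‖+‖iteratedDeriv 2 (Y j) τ‖≤(1+|τ-c p j|)^b) → ∀ L:ℝ, (∀ j τ, ‖deriv (fun s:ℝ => T p (fun k σ
      => X p k σ+s•Y k σ) j τ) 0‖≤L*(1+|τ-c p j|)^a) → ∀ j τ, ‖Y j τ‖≤cnd*L*(1+|τ-c p j|)^b))) → ∃
      (C₀ M:ℝ) (U:(Fin N→ℝ) → EuclideanSpace ℝ (Fin 3) → EuclideanSpace ℝ (Fin 3)) (P:(Fin N→ℝ) →
      EuclideanSpace ℝ (Fin 3) → ℝ) (B:(Fin N→ℝ) → Fin N → ℝ), (ContinuousOn B {p:Fin N → ℝ | ∀ i, p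
      i ∈ Icc 0 1} ∧ ∀ p:Fin N → ℝ, (∀ i, p i ∈ Icc 0 1) → U p ≠ 0 ∧ ContDiff ℝ (⊤:ℕ∞) (U p) ∧
      ContDiff ℝ (⊤:ℕ∞) (P p) ∧ VectorCalculus.IsDivFree (U p)∧(∀ y, α p•(cross
      (EuclideanSpace.single 2 1) (U p y)-fderiv ℝ (U p) y (cross (EuclideanSpace.single 2 1)
      y))+(1/2:ℝ)•U p y+(1/2:ℝ)•fderiv ℝ (U p) y y-(Laplacian.laplacian (U p)) y+fderiv ℝ (U p) y (U
      p y)+gradient (P p) y = ∑ j, B p j•D p j y)∧(∀ y, ‖U p y‖≤C₀/(1+‖y‖))∧(∀ y, |P p y|≤M)∧(∀ y,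
      ‖y‖≤Rw*√Γ → (∀ j τ, ρ*√Γ/4≤‖y-X p j τ‖) → ‖U p y-u p (X p) y‖≤η*√Γ))) := by
  unfold TransverseReductionRJ
  constructor
  · intro h N δ ρ K Λ a b cnd η Rw Rb cg θ₀ hN hδ hρ ha hη hRw hRb hcg hθ₀ _ _ _ _ _ _ _
    exact h N δ ρ K Λ a b cnd η Rw Rb cg θ₀ hN hδ hρ ha hη hRw hRb hcg hθ₀
  · intro h N δ ρ K Λ a b cnd η Rw Rb cg θ₀ hN hδ hρ ha hη hRw hRb hcg hθ₀
    by_cases hnd : cg ≤ 1 ∧ θ₀ ≤ 1 ∧ 0 ≤ K ∧ 3/2+δ ≤ Λ ∧ 0 ≤ cnd ∧ (2 ≤ N → ρ ≤ 2*Rw) ∧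
        (N = 1 → 0 < K)
    · obtain ⟨h1, h2, h3, h4, h5, h6, h7⟩ := hnd
      exact h N δ ρ K Λ a b cnd η Rw Rb cg θ₀ hN hδ hρ ha hη hRw hRb hcg hθ₀ h1 h2 h3 h4 h5 h6 h7
    · refine ⟨1, fun Γ hΓ γ α X w c _ _ u v _ T _ hu hv _ _ _ hbox => ?_⟩
      exfalso
      apply hnd
      have hΓ0 : 0 < Γ := by linarith
      have hp₀ : ∀ i : Fin N, (fun _ => (0:ℝ)) i ∈ Icc (0:ℝ) 1 := fun _ => ⟨le_rfl, zero_le_one⟩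
      obtain ⟨-, -, hreg, hsep, hnoret, -, hwdef, -, hwaist, -, hbds, hstag, -, h13⟩ :=
        hbox.2 (fun _ => (0:ℝ)) hp₀
      refine ⟨?_, ?_, ?_, ?_, ?_, ?_, ?_⟩
      · exact cg_le_one hρ hΓ0 (hreg ⟨0, hN⟩).1 (hreg ⟨0, hN⟩).2.2.1 (hnoret ⟨0, hN⟩)
      · exact theta_le_one hθ₀ hbds.1 hbds.2.1
      · exact K_nonneg (c (fun _ => (0:ℝ)) ⟨0, hN⟩) ((hreg ⟨0, hN⟩).2.2.2.1 _)
      · exact (hstag ⟨0, hN⟩).2.2.1.trans (hstag ⟨0, hN⟩).2.2.2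
      · exact cnd_nonneg_ball ⟨0, hN⟩ h13
      · exact fun hN2 => rho_le_two_Rw hΓ0 hN2 hsep hwaist
      · intro hN1
        subst hN1
        exact K_pos_of_single hδ hΓ0 (fun k => Γ * γ (fun _ => (0:ℝ)) k / (4 * Real.pi))
          (hu (fun _ => (0:ℝ))) (hv (fun _ => (0:ℝ))) (fun j => (hreg j).1)
          (fun j => (hreg j).2.2.1) (fun j => (hreg j).2.2.2.1) hwdef (fun j => (hstag j).2.2.1)

/-- **What a refutation of the J-twin must exhibit.** `¬ TransverseReductionRJ` holds if and only if, for some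
NON-DEGENERATE parameter tuple, at arbitrarily large circulation `Γ` the junk-proof tilted, parameter-bounded
skeleton-box class is INHABITED by a box on which every candidate reduced family `(C₀, M, U, P, B)` fails.
Port of `not_transverseReductionR_iff_boxWitness` (p528784). [folklore] -/
theorem not_transverseReductionRJ_iff_boxWitness :
    ¬ TransverseReductionRJ ↔
    (∃ (N:ℕ) (δ ρ K Λ a b cnd η Rw Rb cg θ₀:ℝ), (0 < N ∧ 0 < δ ∧ 0 < ρ ∧ 0 ≤ a ∧ 0 < η ∧ 0 < Rw ∧
      0 < Rb ∧ 0 < cg ∧ 0 < θ₀) ∧ (cg ≤ 1 ∧ θ₀ ≤ 1 ∧ 0 ≤ K ∧ 3/2+δ ≤ Λ ∧ 0 ≤ cnd ∧ (2 ≤ N → ρ ≤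
      2*Rw) ∧ (N = 1 → 0 < K)) ∧ ∀ Γ₁:ℝ, ∃ Γ:ℝ, Γ₁≤Γ ∧ ∃ (γ:(Fin N→ℝ) → Fin N → ℝ) (α:(Fin N→ℝ) → ℝ)
      (X:(Fin N→ℝ) → Fin N → ℝ → EuclideanSpace ℝ (Fin 3)) (w:(Fin N→ℝ) → Fin N → ℝ → ℝ) (c:(Fin
      N→ℝ) → Fin N → ℝ) (m n:(Fin N→ℝ) → Fin N → EuclideanSpace ℝ (Fin 3)) (u:(Fin N→ℝ)→(Fin N → ℝ →
      EuclideanSpace ℝ (Fin 3)) → EuclideanSpace ℝ (Fin 3) → EuclideanSpace ℝ (Fin 3)) (v:(Fin N→ℝ)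
      → EuclideanSpace ℝ (Fin 3) → EuclideanSpace ℝ (Fin 3)) (A:(Fin N→ℝ) → Fin N → (EuclideanSpace
      ℝ (Fin 3) →L[ℝ] EuclideanSpace ℝ (Fin 3))) (T:(Fin N→ℝ)→(Fin N → ℝ → EuclideanSpace ℝ (Fin 3))
      → Fin N → ℝ → EuclideanSpace ℝ (Fin 3)) (D:(Fin N→ℝ) → Fin N → EuclideanSpace ℝ (Fin 3) →
      EuclideanSpace ℝ (Fin 3)), (∀ p Z y, u p Z y = ∑ k, (Γ*γ p k/(4*Real.pi))•∫ σ:ℝ, ((‖y-Z k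
      σ‖^2+1)^(3/2:ℝ))⁻¹•cross (deriv (Z k) σ) (y-Z k σ)) ∧ (∀ p y, v p y = u p (X p) y+(1/2:ℝ)•y-α
      p•cross (EuclideanSpace.single 2 1) y) ∧ (∀ p j, A p j = fderiv ℝ (v p) (X p j (c p j))) ∧ (∀
      p Z j τ, T p Z j τ = (u p Z (Z j τ)+(1/2:ℝ)•Z j τ-α p•cross (EuclideanSpace.single 2 1) (Z j
      τ))-(⟪u p Z (Z j τ)+(1/2:ℝ)•Z j τ-α p•cross (EuclideanSpace.single 2 1) (Z j τ), deriv (Z j)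
      τ⟫_ℝ/‖deriv (Z j) τ‖^2)•deriv (Z j) τ) ∧ (∀ p j y, D p j y = (Real.exp (-(⟪y-X p j (c p j),
      deriv (X p j) (c p j)⟫_ℝ)^2)*((1-Real.exp (-(‖y-X p j (c p j)‖^2-⟪y-X p j (c p j), deriv (X p
      j) (c p j)⟫_ℝ^2)))/(‖y-X p j (c p j)‖^2-⟪y-X p j (c p j), deriv (X p j) (c p j)⟫_ℝ^2)))•cross
      (deriv (X p j) (c p j)) (y-X p j (c p j))) ∧ ((∀ j, ContinuousOn (fun q:(Fin N→ℝ) × ℝ => (α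
      q.1, γ q.1 j, X q.1 j q.2, w q.1 j q.2)) ({p:Fin N → ℝ | ∀ i, p i ∈ Icc 0 1} ×ˢ univ))∧(∀
      p:Fin N → ℝ, (∀ i, p i ∈ Icc 0 1) → α p ≠ 0 ∧ (∀ j, γ p j ≠ 0)∧(∀ j, ContDiff ℝ 2 (X p j) ∧
      Differentiable ℝ (w p j)∧(∀ τ, ‖deriv (X p j) τ‖ = 1)∧(∀ τ, ‖iteratedDeriv 2 (X p j) τ‖*√Γ≤K)
      ∧ Tendsto (fun τ => ‖X p j τ‖) (cocompact ℝ) atTop)∧(∀ j k, j ≠ k → ∀ τ σ, ρ*√Γ≤‖X p j τ-X p k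
      σ‖)∧(∀ j τ σ, ρ*√Γ≤|τ-σ| → cg*ρ*√Γ≤‖X p j τ-X p j σ‖)∧(∀ j τ, cg*|τ-c p j|≤Rw*√Γ+‖X p j τ‖)∧(∀
      j τ, w p j τ = ⟪v p (X p j τ), deriv (X p j) τ⟫_ℝ)∧(∀ j τ, ‖X p j τ‖≤Rb*√(Γ*Real.log Γ) → v p
      (X p j τ) = w p j τ•deriv (X p j) τ)∧(∀ j, ‖X p j (c p j)‖≤Rw*√Γ)∧(∀ j, |⟪deriv (X p j) (c p
      j), EuclideanSpace.single 2 1⟫_ℝ|≤1-θ₀)∧(θ₀≤|α p| ∧ |α p|≤θ₀⁻¹ ∧ ∀ j, θ₀≤|γ p j| ∧ |γ p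
      j|≤θ₀⁻¹)∧(∀ j, w p j (c p j) = 0 ∧ (∀ τ, w p j τ = 0 → τ = c p j) ∧ 3/2+δ≤deriv (w p j) (c p
      j) ∧ deriv (w p j) (c p j)≤Λ)∧(∀ j, Orthonormal ℝ ![deriv (X p j) (c p j), m p j, n p j] ∧ ⟪A
      p j (m p j), m p j⟫_ℝ+⟪A p j (n p j), n p j⟫_ℝ < 0 ∧ ⟪A p j (n p j), m p j⟫_ℝ * ⟪A p j (m p
      j), n p j⟫_ℝ < ⟪A p j (m p j), m p j⟫_ℝ * ⟪A p j (n p j), n p j⟫_ℝ)∧(∀ Y:Fin N → ℝ →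
      EuclideanSpace ℝ (Fin 3), (∀ j, ContDiff ℝ 2 (Y j))→(∀ j τ, ⟪Y j τ, deriv (X p j) τ⟫_ℝ = 0) →
      (∀ j τ, Rb*√(Γ*Real.log Γ) < ‖X p j τ‖ → Y j τ = 0) → ∑ j, ⟪Y j (c p j), cross
      (EuclideanSpace.single 2 1) (X p j (c p j))⟫_ℝ = 0 → (∀ j τ, ‖Y j τ‖+‖deriv (Y j)
      τ‖+‖iteratedDeriv 2 (Y j) τ‖≤(1+|τ-c p j|)^b) → ∀ L:ℝ, (∀ j τ, ‖deriv (fun s:ℝ => T p (fun k σ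
      => X p k σ+s•Y k σ) j τ) 0‖≤L*(1+|τ-c p j|)^a) → ∀ j τ, ‖Y j τ‖≤cnd*L*(1+|τ-c p j|)^b))) ∧ ∀
      (C₀ M:ℝ) (U:(Fin N→ℝ) → EuclideanSpace ℝ (Fin 3) → EuclideanSpace ℝ (Fin 3)) (P:(Fin N→ℝ) →
      EuclideanSpace ℝ (Fin 3) → ℝ) (B:(Fin N→ℝ) → Fin N → ℝ), ¬ (ContinuousOn B {p:Fin N → ℝ | ∀ i,
      p i ∈ Icc 0 1} ∧ ∀ p:Fin N → ℝ, (∀ i, p i ∈ Icc 0 1) → U p ≠ 0 ∧ ContDiff ℝ (⊤:ℕ∞) (U p) ∧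
      ContDiff ℝ (⊤:ℕ∞) (P p) ∧ VectorCalculus.IsDivFree (U p)∧(∀ y, α p•(cross
      (EuclideanSpace.single 2 1) (U p y)-fderiv ℝ (U p) y (cross (EuclideanSpace.single 2 1)
      y))+(1/2:ℝ)•U p y+(1/2:ℝ)•fderiv ℝ (U p) y y-(Laplacian.laplacian (U p)) y+fderiv ℝ (U p) y (U
      p y)+gradient (P p) y = ∑ j, B p j•D p j y)∧(∀ y, ‖U p y‖≤C₀/(1+‖y‖))∧(∀ y, |P p y|≤M)∧(∀ y,
      ‖y‖≤Rw*√Γ → (∀ j τ, ρ*√Γ/4≤‖y-X p j τ‖) → ‖U p y-u p (X p) y‖≤η*√Γ))) := by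
  rw [transverseReductionRJ_iff_nondegenerate]
  constructor
  · intro h
    by_contra hc
    apply h
    intro N δ ρ K Λ a b cnd η Rw Rb cg θ₀ hN hδ hρ ha hη hRw hRb hcg hθ₀ h1 h2 h3 h4 h5 h6 h7
    by_contra hΓ
    apply hc
    refine ⟨N, δ, ρ, K, Λ, a, b, cnd, η, Rw, Rb, cg, θ₀, ⟨hN, hδ, hρ, ha, hη, hRw, hRb, hcg, hθ₀⟩,
      ⟨h1, h2, h3, h4, h5, h6, h7⟩, fun Γ₁ => ?_⟩
    by_contra hΓ'
    apply hΓ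
    refine ⟨Γ₁, fun Γ hle γ α X w c m n u v A T D hu hv hA hT hD hbox => ?_⟩
    by_contra hconc
    apply hΓ'
    exact ⟨Γ, hle, γ, α, X, w, c, m, n, u, v, A, T, D, hu, hv, hA, hT, hD, hbox,
      fun C₀ M U P B hc' => hconc ⟨C₀, M, U, P, B, hc'⟩⟩
  · rintro ⟨N, δ, ρ, K, Λ, a, b, cnd, η, Rw, Rb, cg, θ₀, ⟨hN, hδ, hρ, ha, hη, hRw, hRb, hcg, hθ₀⟩,
      ⟨h1, h2, h3, h4, h5, h6, h7⟩, hw⟩ h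
    obtain ⟨Γ₁, hΓ₁⟩ :=
      h N δ ρ K Λ a b cnd η Rw Rb cg θ₀ hN hδ hρ ha hη hRw hRb hcg hθ₀ h1 h2 h3 h4 h5 h6 h7
    obtain ⟨Γ, hle, γ, α, X, w, c, m, n, u, v, A, T, D, hu, hv, hA, hT, hD, hbox, hno⟩ := hw Γ₁
    obtain ⟨C₀, M, U, P, B, hc⟩ := hΓ₁ Γ hle γ α X w c m n u v A T D hu hv hA hT hD hbox
    exact hno C₀ M U P B hc

end Summit.NavierStokesRegularity.NavierStokesRegularity.Theorems
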